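import Literature.NumberTheory.PAdicHodge.LabelledWeightsRankOneThetaPeriod
import Literature.NumberTheory.GaloisRepresentations.LabelledWeightsRankOneBaseChange
import HarnessLib

/-!
# One `ℂ_F`-period determines the labelled weight: `ℚ̄_p`-coefficients and THE datum `fontainePst`

The accepted `RankOneLabelledWeights.labelledHodgeTateWeights_eq_singleton_of_theta_period` computes
`HT_τ(rE) = {n}` for a `B_dR`-admissible character `rE : Γ_F → GL₁(E)` over a FINITE `E/ℚ_p` from one
nonzero `ℂ_F`-period with exponent `n`.  Here it is transported to characters
`ρ : Γ_F → GL₁(ℚ̄_p)` given with a finite model `rE` over `E' ⊆ ℚ̄_p` (`HasQlModel`), for Fontaine's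
`B_dR(F)` (`bdRPeriodRingData hp`) and for THE summit datum `fontainePst F p hp`:

* `labelledHodgeTateWeights_eq_singleton_of_theta_period_of_hasQlModel` — `B_dR(F)`, any
  `ℚ_p`-structure on `F`;
* `fontainePst_labelledHodgeTateWeights_eq_singleton_of_theta_period` — the datum `fontainePst F p hp`
  and a label `τ : F →+* ℚ̄_p` through `E'`.

Proof: `ρ = Q (rE ⊗_{E'} ℚ̄_p) Q⁻¹` (the model), the labelled weights are insensitive to `Q`
(`labelledHodgeTateWeights_conj`) and — in rank one — to the extension of coefficients
(`labelledHodgeTateWeights_baseChange_of_finrank_eq_one`, `D_{τ₀}(rE)` being an `E'`-line by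
`finrank_labelD_eq_of_isAdmissible` and model independence of admissibility
`isAdmissible_of_hasQlModel`); then the finite-model theorem applies.

## References
* [SerreAbelianLadic1968] J.-P. Serre, *Abelian ℓ-adic representations*, Ch. III App. A.5.
* [FontaineAsterisque223III] J.-M. Fontaine, Astérisque 223, Exp. III §1.5, Prop. 1.5.2.
* [Patrikis2019] S. Patrikis, *Variations on a theorem of Tate*, §2.3.1, §2.7.1.
* [BuzzardGeeLMS2014] K. Buzzard, T. Gee, §2.2 (finite models).
-/

noncomputable section

open Field ValuativeRel Matrix WittVector
open scoped MatrixGroups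

namespace Literature.NumberTheory.PAdicHodge

open Literature.NumberTheory.GaloisRepresentations
open Literature.NumberTheory.GaloisRepresentations.IsNonarchimedeanLocalField
open Literature.NumberTheory.Automorphic PeriodRingData

namespace RankOneLabelledWeights

-- Mathlib's own global value of `maxSynthPendingDepth` (see `LabelledWeightsTwist`); the large
-- tensor types also need a higher instance-synthesis budget.
set_option maxSynthPendingDepth 3
set_option synthInstance.maxHeartbeats 200000

variable {F : Type} [Field F] [ValuativeRel F] [TopologicalSpace F] [IsNonarchimedeanLocalField F]
  [CharZero F] {p : ℕ} [Fact p.Prime]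

set_option maxHeartbeats 400000 in
/-- **One `ℂ_F`-period determines the labelled weight, `ℚ̄_p`-coefficients.**  Let
`ρ : Γ_F → GL₁(ℚ̄_p)` be de Rham for `B_dR(F) = bdRPeriodRingData hp`, with a finite model `rE` over
`E' ⊆ ℚ̄_p` containing every `ℚ_p`-embedding of `F`; let `τ : F → ℚ̄_p` be a label, `τ₀ : F → E'` its
corestriction and `j : E' → F̄` a `ℚ_p`-embedding over `τ₀`.  If `y ∈ ℂ_F ∖ 0` satisfies
`y = j(det rE σ) · χ(σ)^n · σ(y)` for all `σ ∈ Γ_F` fixing a finite `M/F` pointwise, then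
`HT_τ(ρ) = {n}`. [cite: SerreAbelianLadic1968, Ch. III §A.5 Thm. 2]
[cite: FontaineAsterisque223III, Exp. III §1.5, Prop. 1.5.2] [cite: Patrikis2019, §2.7.1] -/
theorem labelledHodgeTateWeights_eq_singleton_of_theta_period_of_hasQlModel
    [Fact (¬ IsUnit (p : integerC F))] [IsAdicComplete (Ideal.span {(p : integerC F)}) (integerC F)]
    [Algebra ℚ_[p] F] [FiniteDimensional ℚ_[p] F] (hp : valuation F p < 1)
    {ρ : FramedRep (absoluteGaloisGroup F) (PadicAlgCl p) 1}
    (hρ : ρ.IsDeRhamWith ‹Algebra ℚ_[p] F› (bdRPeriodRingData (F := F) (p := p) hp))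
    {E' : IntermediateField ℚ_[p] (PadicAlgCl p)} [FiniteDimensional ℚ_[p] E']
    (hE' : ∀ φ : F →ₐ[ℚ_[p]] PadicAlgCl p, φ.fieldRange ≤ E')
    {rE : FramedRep (absoluteGaloisGroup F) E' 1} (hmodel : HasQlModel ρ E' rE)
    (τ : F →ₐ[ℚ_[p]] PadicAlgCl p) (τ₀ : F →ₐ[ℚ_[p]] E')
    (hτ : ∀ a : F, ((τ₀ a : E') : PadicAlgCl p) = τ a)
    (j : E' →ₐ[ℚ_[p]] AlgebraicClosure F)
    (hj : ∀ a : F, j (τ₀ a) = algebraMap F (AlgebraicClosure F) a)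
    (M : IntermediateField F (NormedAlgClosure F)) [FiniteDimensional F M] {n : ℤ}
    {y : CompletedAlgClosure F} (hy0 : y ≠ 0)
    (hy : ∀ σ : absoluteGaloisGroup F, (∀ m ∈ M, σ • m = m) →
      y = algClosureToC F (j ((FramedRep.det rE σ : E'ˣ) : E')) *
        (algebraMap F (CompletedAlgClosure F)
          (LocalField.padicRingHom F p hp
            (((GaloisRep.cyclotomicCharacter F p σ : ℤ_[p]ˣ) : ℤ_[p]) : ℚ_[p]))) ^ n * σ • y) :
    (bdRPeriodRingData (F := F) (p := p) hp).labelledHodgeTateWeights (FramedRep.toContinuousRep ρ)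
      τ.toRingHom = {n} := by
  classical
  have hF : Function.Surjective (fontaineTheta (integerC F) p) := surjective_fontaineTheta_integerC hp
  haveI : IsDomain (BDeRhamPlus (integerC F) p) := isDomain_bDeRhamPlus hF
  haveI : Algebra.IsSeparable ℚ_[p] F := Algebra.IsSeparable.of_integral ℚ_[p] F
  have hsplit := card_algHom_eq_finrank_of_forall_fieldRange_le (K := F) E' hE'
  obtain ⟨Q, hQ⟩ := hmodel
  have hρeq : ρ = (rE.baseChange (algebraMap E' (PadicAlgCl p)) continuous_subtype_val).conj Q :=
    hQ.symm
  -- the model is admissible (model independence of de Rham-ness)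
  have hadm : (bdRPeriodRingData (F := F) (p := p) hp).IsAdmissible
      ((FramedRep.toContinuousRep rE).restrictScalars ℚ_[p]) :=
    hρ.isAdmissible_of_hasQlModel ‹Algebra ℚ_[p] F› _ ⟨Q, hQ⟩
  -- the label factors through `E'`
  have hτ' : τ.toRingHom = (extEmb (E := PadicAlgCl p) τ₀).toRingHom :=
    RingHom.ext fun a => (hτ a).symm
  -- `D_{τ₀}(rE)` is an `E'`-line
  haveI : ContinuousSMul ℚ_[p] E' := IntermediateField.continuousSMul_padicAlgCl E'
  have hB : IsField (bdRPeriodRingData (F := F) (p := p) hp).B := Field.toIsField (FracBdR F p)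
  obtain ⟨hfinE', hrank⟩ :=
    (bdRPeriodRingData (F := F) (p := p) hp).finrank_labelD_eq_of_isAdmissible hB (E := E')
      hsplit rE hadm τ₀
  haveI := hfinE'
  rw [hρeq, PeriodRingData.labelledHodgeTateWeights_conj, hτ',
    (bdRPeriodRingData (F := F) (p := p) hp).labelledHodgeTateWeights_baseChange_of_finrank_eq_one
      rE continuous_subtype_val hsplit τ₀ hrank]
  exact labelledHodgeTateWeights_eq_singleton_of_theta_period hp hsplit rE hadm τ₀ j hj M hy0 hy

/-- **… for THE summit datum `fontainePst F p hp`** (its period ring IS `B_dR(F)` and its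
`ℚ_p`-structure the canonical one): for `ρ : Γ_F → GL₁(ℚ̄_p)` de Rham for `fontainePst F p hp` with a
finite model `rE` over `E' ⊇` the embeddings of `F`, a label `τ : F →+* ℚ̄_p` with corestriction
`τ₀ : F → E'`, an embedding `j : E' → F̄` over `τ₀`, and one nonzero `ℂ_F`-period
`y = j(det rE σ) · χ(σ)^n · σ(y)` on `Gal(F̄/M)`, `M/F` finite:  `HT_τ(ρ) = {n}`.
[cite: SerreAbelianLadic1968, Ch. III §A.5 Thm. 2] [cite: FontaineAsterisque223III, Exp. III §1.5,
Prop. 1.5.2] [cite: Patrikis2019, §2.7.1] -/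
theorem fontainePst_labelledHodgeTateWeights_eq_singleton_of_theta_period (hp : valuation F p < 1)
    {ρ : FramedRep (absoluteGaloisGroup F) (PadicAlgCl p) 1}
    (hρ : (fontainePst F p hp).IsDeRhamFramed ρ)
    {E' : IntermediateField ℚ_[p] (PadicAlgCl p)} [FiniteDimensional ℚ_[p] E']
    (hE' : letI := (fontainePst F p hp).algebra; ∀ φ : F →ₐ[ℚ_[p]] PadicAlgCl p, φ.fieldRange ≤ E')
    {rE : FramedRep (absoluteGaloisGroup F) E' 1} (hmodel : HasQlModel ρ E' rE)
    (τ : F →+* PadicAlgCl p) (τ₀ : letI := (fontainePst F p hp).algebra; F →ₐ[ℚ_[p]] E')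
    (hτ : ∀ a : F, ((τ₀ a : E') : PadicAlgCl p) = τ a)
    (j : letI := (fontainePst F p hp).algebra; E' →ₐ[ℚ_[p]] AlgebraicClosure F)
    (hj : letI := (fontainePst F p hp).algebra; ∀ a : F, j (τ₀ a) = algebraMap F (AlgebraicClosure F) a)
    (M : IntermediateField F (NormedAlgClosure F)) [FiniteDimensional F M] {n : ℤ}
    {y : CompletedAlgClosure F} (hy0 : y ≠ 0)
    (hy : letI := (fontainePst F p hp).algebra; ∀ σ : absoluteGaloisGroup F, (∀ m ∈ M, σ • m = m) →
      y = algClosureToC F (j ((FramedRep.det rE σ : E'ˣ) : E')) *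
        (algebraMap F (CompletedAlgClosure F)
          (LocalField.padicRingHom F p hp
            (((GaloisRep.cyclotomicCharacter F p σ : ℤ_[p]ˣ) : ℤ_[p]) : ℚ_[p]))) ^ n * σ • y) :
    letI := (fontainePst F p hp).algebra
    (fontainePst F p hp).𝔅.labelledHodgeTateWeights (FramedRep.toContinuousRep ρ) τ = {n} := by
  haveI : Fact (¬ IsUnit (p : integerC F)) := ⟨not_isUnit_natCast_integerC hp⟩
  haveI : IsAdicComplete (Ideal.span {(p : integerC F)}) (integerC F) :=
    isAdicComplete_integerC_natCast hp
  letI := (fontainePst F p hp).algebra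
  haveI : FiniteDimensional ℚ_[p] F := fontainePst_finiteDimensional hp
  -- `τ` is `ℚ_p`-linear, being `(E' ⊆ ℚ̄_p) ∘ τ₀`
  let τa : F →ₐ[ℚ_[p]] PadicAlgCl p :=
    { τ with
      commutes' := fun c => by
        change τ (algebraMap ℚ_[p] F c) = algebraMap ℚ_[p] (PadicAlgCl p) c
        rw [← hτ, τ₀.commutes]
        rfl }
  have hτa : τa.toRingHom = τ := RingHom.ext fun _ => rfl
  have hρ' : ρ.IsDeRhamWith (fontainePst F p hp).algebra (bdRPeriodRingData (F := F) (p := p) hp) := by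
    rw [← fontainePst_𝔅_eq_bdRPeriodRingData hp]; exact hρ
  rw [fontainePst_𝔅_eq_bdRPeriodRingData hp, ← hτa]
  exact labelledHodgeTateWeights_eq_singleton_of_theta_period_of_hasQlModel hp hρ' hE' hmodel τa τ₀
    hτ j hj M hy0 hy

end RankOneLabelledWeights

end Literature.NumberTheory.PAdicHodge
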